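import Mathlib
import Literature.NumberTheory.LFunctions.Zhang2022.Section11WindowCoefficients
import Literature.NumberTheory.LFunctions.Zhang2022.Section11Lemma111
import HarnessLib

/-!
# Zhang (2022) §11 p. 64: the SHARP size of the window coefficients, `|f̃ − g̃₁| ≤ 1000·𝓛⁻²⁴`

Topic `Literature/NumberTheory/LFunctions/Zhang2022` (Landau–Siegel audit tree; verdict-neutral).
Y. Zhang, *Discrete mean estimates and the Landau–Siegel zero*, arXiv:2211.02515v1 (2022)
[Zhang2022LandauSiegel] — **an unrefereed manuscript under adjudication; nothing here asserts or
denies its Theorems 1–2.** Companion of `Section11WindowCoefficients` (zl-libB-p3) for the leaves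
h19/h19J2 = `Typed.TypedSection11B.Step11u019` / `Step11u019J2` (cell GAP row G-L3t10-1).

The printed (11.3) of Lemma 11.1 — "`f̃(log y/log P) − g̃₁(y) ≪ 𝓛⁻¹⁰` on the windows `𝔍₁`" — is
what the tree exports (`Lemma111.abs_ftilde_sub_le_inv`, constant `1000·𝓛⁻¹⁰`;
`Section11WindowMeanSquare.norm_window_le`). The tree's own proof of Lemma 11.1 is sharper: the
uniform position lemma `SmoothedStep.integral_step_crude` gives, for EVERY `y > 0` and every
interval `[a,b]`, `|∫_a^b g(P^z/y)dz − (b − clamp(log y/log P; a, b))| ≤ ½√(π/(𝓛³⁰(𝓛⁹)²)) = ½√π·𝓛⁻²⁴`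
(`g = g_{𝓛³⁰}` of (4.1), `log P = 𝓛⁹`), and `f̃` is exactly the clamp combination
(`Lemma111.ftilde_eq_clamp`), whence

* `abs_ftilde_sub_gtilde1_le_sharp` — **`|f̃(log y/log P) − g̃₁(y)| ≤ 1000·𝓛⁻²⁴` for every `y > 0`**
  (`D ≥ 3`; the true order is `𝓛⁻²⁴`: slope `500/log P = 500𝓛⁻⁹` times smoothing width `𝓛⁻¹⁵`);
* `abs_ftilde_sub_gtilde2_le_sharp` — the `J₂`-transport: `|f̃(log y/log P + 0.004 − α̃) − g̃₂(y)| ≤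
  1000·𝓛⁻²⁴` for every `y > 0` (`g̃₂(y) = g̃₁(Y)`, `Y = yP^{0.004}/(Dt₀)`, tree identities
  `gtilde2_eq_gtilde1_scaleJ2`, `tentArg_J2_eq`);
* `norm_window_le_sharp` / `norm_window₂_le_sharp` — the two inline window sequences of
  `Section11WindowMeanSquare(J2)` are bounded by `1000·𝓛⁻²⁴` termwise (shapes of
  `norm_window_le` / `norm_window₂_le` with `1000·(ell D ^ 24)⁻¹` in place of `C·(ell D ^ 10)⁻¹`).

Use (arithmetic half of h19/h19J2, zl-w11-p4's `S_j`-window engine `‖S_j(𝐚₁,𝐚₂)‖ ≤ B₁B₂·C·𝓛⁸`):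
`B₁ = B₂ = 1000𝓛⁻²⁴` instead of `C_L𝓛⁻¹⁰` turns the closing budget `𝓛⁹‖S_j‖ ≤ C𝓛⁻³` into
`≤ C𝓛⁻³¹`. 0 new definitions, 0 facts; standard axioms.

## References

* Y. Zhang, arXiv:2211.02515v1 (2022), §11 Lemma 11.1 (11.3) p. 63 and its proof pp. 63–64
  (tex L3238–L3289), p. 64 (tex L3295–L3307), §2 (2.28)–(2.30), §4 (4.1).
  [cite: Zhang2022LandauSiegel, §11 Lemma 11.1, pp. 63–64]
-/

noncomputable section

open Complex Real ComplexConjugate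

namespace Literature.NumberTheory.LFunctions.Zhang2022.Section11WindowMeanSquare

open Literature.NumberTheory.LFunctions.Zhang2022.Skeleton
open Literature.NumberTheory.LFunctions.Zhang2022.Typed.TypedSection11B

/-! ### The sharp constant -/

/-- `½√(π/(𝓛³⁰(𝓛⁹)²)) = ½√π·𝓛⁻²⁴ ≤ 𝓛⁻²⁴` (`𝓛 > 0`, `π ≤ 4`). [folklore] -/
private theorem half_sqrt_le_inv_ell_pow_24 {D : ℕ} (hL : 0 < ell D) :
    (1 / 2) * Real.sqrt (π / (ell D ^ 30 * (ell D ^ 9) ^ 2)) ≤ (ell D ^ 24)⁻¹ := by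
  have h48 : ell D ^ 30 * (ell D ^ 9) ^ 2 = (ell D ^ 24) ^ 2 := by ring
  have hsq : Real.sqrt (π / (ell D ^ 30 * (ell D ^ 9) ^ 2)) ≤ 2 / ell D ^ 24 := by
    rw [h48]
    calc Real.sqrt (π / (ell D ^ 24) ^ 2) ≤ Real.sqrt ((2 / ell D ^ 24) ^ 2) := by
          apply Real.sqrt_le_sqrt
          rw [div_pow]
          exact div_le_div_of_nonneg_right (by nlinarith [Real.pi_lt_four]) (by positivity)
      _ = 2 / ell D ^ 24 := Real.sqrt_sq (by positivity)
  calc (1 / 2) * Real.sqrt (π / (ell D ^ 30 * (ell D ^ 9) ^ 2)) ≤ (1 / 2) * (2 / ell D ^ 24) := by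
        gcongr
    _ = (ell D ^ 24)⁻¹ := by ring

/-- `g(P^z/y)` is the smoothed step of `Section11SmoothedStep` with `Λ = 𝓛³⁰`, `K = 𝓛⁹`
(`P^z = e^{𝓛⁹z}`, (2.6)). [cite: Zhang2022LandauSiegel, §11 p. 63; §2 (2.6)] -/
theorem gW_bigP_rpow_div_eq (D : ℕ) (y z : ℝ) :
    gW D (bigP D ^ z / y) = GaussWeight.gWeight (ell D ^ 30) (Real.exp (ell D ^ 9 * z) / y) := by
  rw [gW, bigP, ← Real.exp_mul]

/-! ### (11.3), sharp and for every `y > 0` -/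

/-- **Sharp (11.3)**: for `D ≥ 3` and EVERY `y > 0`,
`|f̃(log y/log P) − g̃₁(y)| ≤ 1000·𝓛⁻²⁴` (`g̃₁(y) = −500∫_{0.5}^{0.502} g(P^z/y)dz + 500∫_{0.502}^{0.504} g(P^z/y)dz`;
each integral is within `½√π·𝓛⁻²⁴` of the corresponding clamp length, and `f̃` is the clamp
combination). [cite: Zhang2022LandauSiegel, §11 Lemma 11.1 (11.3) p. 63, proof pp. 63–64] -/
theorem abs_ftilde_sub_gtilde1_le_sharp {D : ℕ} (hD : 3 ≤ D) {y : ℝ} (hy : 0 < y) :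
    |ftilde (Real.log y / Real.log (bigP D)) - gtilde1 D y| ≤ 1000 * (ell D ^ 24)⁻¹ := by
  have hL1 : 1 < ell D := one_lt_ell hD
  have hL : 0 < ell D := by linarith
  have hΛ : 0 < ell D ^ 30 := pow_pos hL 30
  have hK : 0 < ell D ^ 9 := pow_pos hL 9
  rw [gtilde1]
  simp only [gW_bigP_rpow_div_eq, log_bigP]
  have hI1 := SmoothedStep.integral_step_crude hΛ hK hy (a := 0.5) (b := 0.502) (by norm_num)
  have hI2 := SmoothedStep.integral_step_crude hΛ hK hy (a := 0.502) (b := 0.504) (by norm_num)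
  have hM := half_sqrt_le_inv_ell_pow_24 hL
  rw [Lemma111.ftilde_eq_clamp]
  rw [abs_le] at hI1 hI2 ⊢
  constructor <;> nlinarith

/-- **Sharp (11.3), `J₂`-transport** ("Similarly", p. 64): for `D ≥ 3` and every `y > 0`,
`|f̃(log y/log P + 0.004 − α̃) − g̃₂(y)| ≤ 1000·𝓛⁻²⁴` — since `g̃₂(y) = g̃₁(Y)` and
`log y/log P + 0.004 − α̃ = log Y/log P` with `Y = yP^{0.004}/(Dt₀) > 0`.
[cite: Zhang2022LandauSiegel, §11 p. 64 tex L3306; §2 (2.30)] -/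
theorem abs_ftilde_sub_gtilde2_le_sharp {D : ℕ} (hD : 3 ≤ D) {y : ℝ} (hy : 0 < y) :
    |ftilde (Real.log y / Real.log (bigP D) + 0.004 - alphaTilde D) - gtilde2 D y| ≤
      1000 * (ell D ^ 24)⁻¹ := by
  have hD2 : 2 ≤ D := le_trans (by norm_num) hD
  rw [tentArg_J2_eq hD2 hy, gtilde2_eq_gtilde1_scaleJ2 hD2]
  exact abs_ftilde_sub_gtilde1_le_sharp hD (scaleJ2_pos hD2 hy)

/-- **Sharp (11.3) on `𝔍₁ ∩ ℕ`** in the `ForAllLarge` frame of `abs_ftilde_sub_gtilde1_le`: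
`|f̃(log n/log P) − g̃₁(n)| ≤ 1000·𝓛⁻²⁴` for `n ∈ frakI1Nat D`, `D ≥ 3`.
[cite: Zhang2022LandauSiegel, §11 Lemma 11.1 (11.3), p. 63] -/
theorem abs_ftilde_sub_gtilde1_le_sharp_forAllLarge :
    ForAllLarge fun D _ _ => ∀ n ∈ frakI1Nat D,
      |ftilde (Real.log n / Real.log (bigP D)) - gtilde1 D n| ≤ 1000 * (ell D ^ 24)⁻¹ := by
  refine ⟨3, fun D _ χ hD hq hp n hn => ?_⟩
  have hn0 : (0 : ℝ) < n := by exact_mod_cast (pos_and_lt_of_mem_frakI1Nat D hn).1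
  exact abs_ftilde_sub_gtilde1_le_sharp hD hn0

/-- **Sharp (11.3) on `𝔍₂ ∩ ℕ`** in the `ForAllLarge` frame of `abs_ftilde_sub_gtilde2_le`:
`|f̃(log n/log P + 0.004 − α̃) − g̃₂(n)| ≤ 1000·𝓛⁻²⁴` for `n ∈ frakI2Nat D`, `D ≥ 3`.
[cite: Zhang2022LandauSiegel, §11 p. 64 tex L3306] -/
theorem abs_ftilde_sub_gtilde2_le_sharp_forAllLarge :
    ForAllLarge fun D _ _ => ∀ n ∈ frakI2Nat D,
      |ftilde (Real.log n / Real.log (bigP D) + 0.004 - alphaTilde D) - gtilde2 D n| ≤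
        1000 * (ell D ^ 24)⁻¹ := by
  refine ⟨3, fun D _ χ hD hq hp n hn => ?_⟩
  have hD2 : 2 ≤ D := le_trans (by norm_num) hD
  have hn0 : (0 : ℝ) < n := by exact_mod_cast (pos_and_lt_of_mem_frakI2Nat D hD2 hn).1
  exact abs_ftilde_sub_gtilde2_le_sharp hD hn0

/-! ### The window sequences are `≤ 1000·𝓛⁻²⁴` termwise -/

/-- **The `𝔍₁`-window sequence is bounded by `1000·𝓛⁻²⁴` termwise** (`|χ| ≤ 1` and the sharp
(11.3); off `𝔍₁ ∩ ℕ` it is `0`), `D ≥ 3` — the shape of `norm_window_le` with the sharp constant.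
[cite: Zhang2022LandauSiegel, §11 p. 64, tex L3295–L3301] -/
theorem norm_window_le_sharp :
    ForAllLarge fun D _ χ => ∀ n : ℕ,
      ‖(if n ∈ frakI1Nat D then χ (n : ZMod D) *
        (((ftilde (Real.log n / Real.log (bigP D)) : ℝ) : ℂ) - ((gtilde1 D n : ℝ) : ℂ)) else 0)‖ ≤
        1000 * (ell D ^ 24)⁻¹ := by
  obtain ⟨D₀, h⟩ := abs_ftilde_sub_gtilde1_le_sharp_forAllLarge
  refine ⟨D₀, fun D _ χ hD hq hp n => ?_⟩
  have hℓ : 0 ≤ (ell D ^ 24)⁻¹ := inv_nonneg.mpr (pow_nonneg (Real.log_natCast_nonneg D) 24)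
  by_cases hn : n ∈ frakI1Nat D
  · rw [if_pos hn, norm_mul, ← Complex.ofReal_sub, Complex.norm_real, Real.norm_eq_abs]
    calc ‖χ (n : ZMod D)‖ * |ftilde (Real.log n / Real.log (bigP D)) - gtilde1 D n|
        ≤ 1 * (1000 * (ell D ^ 24)⁻¹) :=
          mul_le_mul (DirichletCharacter.norm_le_one _ _) (h D χ hD hq hp n hn) (abs_nonneg _)
            zero_le_one
      _ = 1000 * (ell D ^ 24)⁻¹ := one_mul _
  · rw [if_neg hn, norm_zero]; positivity

/-- **The `𝔍₂`-window sequence is bounded by `1000·𝓛⁻²⁴` termwise**, `D ≥ 3` — the shape of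
`norm_window₂_le` with the sharp constant. [cite: Zhang2022LandauSiegel, §11 p. 64, tex L3306] -/
theorem norm_window₂_le_sharp :
    ForAllLarge fun D _ χ => ∀ n : ℕ,
      ‖(if n ∈ frakI2Nat D then χ (n : ZMod D) *
        (((ftilde (Real.log n / Real.log (bigP D) + 0.004 - alphaTilde D) : ℝ) : ℂ) -
          ((gtilde2 D n : ℝ) : ℂ)) else 0)‖ ≤ 1000 * (ell D ^ 24)⁻¹ := by
  obtain ⟨D₀, h⟩ := abs_ftilde_sub_gtilde2_le_sharp_forAllLarge
  refine ⟨D₀, fun D _ χ hD hq hp n => ?_⟩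
  have hℓ : 0 ≤ (ell D ^ 24)⁻¹ := inv_nonneg.mpr (pow_nonneg (Real.log_natCast_nonneg D) 24)
  by_cases hn : n ∈ frakI2Nat D
  · rw [if_pos hn, norm_mul, ← Complex.ofReal_sub, Complex.norm_real, Real.norm_eq_abs]
    calc ‖χ (n : ZMod D)‖ *
          |ftilde (Real.log n / Real.log (bigP D) + 0.004 - alphaTilde D) - gtilde2 D n|
        ≤ 1 * (1000 * (ell D ^ 24)⁻¹) :=
          mul_le_mul (DirichletCharacter.norm_le_one _ _) (h D χ hD hq hp n hn) (abs_nonneg _)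
            zero_le_one
      _ = 1000 * (ell D ^ 24)⁻¹ := one_mul _
  · rw [if_neg hn, norm_zero]; positivity

/-- **Sharp (11.3) in the `∃ C` shape of `norm_window_le`** (`C = 1000`, exponent `24`), for
consumers that quantify the constant. [cite: Zhang2022LandauSiegel, §11 p. 64] -/
theorem norm_window_le_sharp' :
    ∃ C : ℝ, 0 ≤ C ∧ ForAllLarge fun D _ χ => ∀ n : ℕ,
      ‖(if n ∈ frakI1Nat D then χ (n : ZMod D) *
        (((ftilde (Real.log n / Real.log (bigP D)) : ℝ) : ℂ) - ((gtilde1 D n : ℝ) : ℂ)) else 0)‖ ≤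
        C * (ell D ^ 24)⁻¹ :=
  ⟨1000, by norm_num, norm_window_le_sharp⟩

/-- **Sharp (11.3) for the `𝔍₂`-window sequence in the `∃ C` shape** (`C = 1000`, exponent `24`).
[cite: Zhang2022LandauSiegel, §11 p. 64 tex L3306] -/
theorem norm_window₂_le_sharp' :
    ∃ C : ℝ, 0 ≤ C ∧ ForAllLarge fun D _ χ => ∀ n : ℕ,
      ‖(if n ∈ frakI2Nat D then χ (n : ZMod D) *
        (((ftilde (Real.log n / Real.log (bigP D) + 0.004 - alphaTilde D) : ℝ) : ℂ) -
          ((gtilde2 D n : ℝ) : ℂ)) else 0)‖ ≤ C * (ell D ^ 24)⁻¹ :=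
  ⟨1000, by norm_num, norm_window₂_le_sharp⟩

end Literature.NumberTheory.LFunctions.Zhang2022.Section11WindowMeanSquare
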